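import Summits.QuantumFields.BalabanUV.Beta.FP.PerfectPairSiteSwap
import Summits.QuantumFields.BalabanUV.Beta.FP.SliceContactChart
import Summits.QuantumFields.BalabanUV.Beta.FP.PerfectPropagatorReflection

/-!
# `BalabanUV.Beta.FP.PerfectLegSwapReflection` — road «FP», binder row D1, sub-row **H2-ASM-5a (Kcov)**, module R12 (located finding N-d1leaf02g11-1):
# THE CELL's REFLECTION LEG MAPS `Φ N α` FIX THE SITE-SWAPPED PERFECT LEG `Pkerˢˢ`, AND RETURN `Pker` AS TYPED TWISTED BY A FIBRE-DEPENDENT SHIFT;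
# the swapped pair's letters and the R5′ socket's consistency identity at `(Pkerˢˢ, MFˢˢ, idF)`

HONEST DEPENDENCY (page 1, mandatory): continuum YM on T⁴ ⇐ BetaPertH ∧ nine spine estimates (0/9 proved); BetaPertH ⇐ (D1) ∧ (D4) ∧ CAP+tail;
G-an2-4 gates asym, D1 and NE2/3/4.  HONEST FRAMING (cell contract, verbatim): «discharging `BetaPertH` makes Bałaban's UV stability UNCONDITIONAL —
a real constructive-QFT result; it is NOT the continuum limit and NOT the Clay problem.»  THIS MODULE DISCHARGES NOTHING of the wall: finite index algebra on
OUR explicit objects (`PerfectPolarization.Pker`, `PerfectPropagatorInverse.MF`∕`idF`, `ResolventReflection.Φ`∕`bref`) over `PerfectPropagatorReflection.PinfKer_axisReflect`,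
R9 `PerfectPairSiteSwap`, R7 `SliceContactChart` and R6 `ChartConjugationBounded.consistency_contact₂_of_conj` BY NAME; 0 def, 0 `def … : Prop`, nothing cited, 0 sorry;
0 estimates; 0∕4 row-D1 binders; NOT the (Kcov) instance, NOT H2V-4, NOT D1, NOT BetaPertH, NOT continuum, NOT Clay.

ABSOLUTE RULE (cell charter, verbatim): «No internally-minted statement may enter as a cited fact. Every hypothesis is either kernel-proved in this package or a
verbatim quotation of a PUBLISHED theorem with page reference. The manuscript(s) under audit are NOT citable for their own disputed steps — they are the thing
under adjudication; programme-internal (2001/route/tribunal) claims are never citable.»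

THE FINDING (N-d1leaf02g11-1; about OUR typed objects only).  The cell's leg map `Φ N α` moves a field leg of direction `κ` by `bref α κ = sref α − [κ=α]e_α`, so
`bref α β x − bref α γ z = ε(x − z) − [β=α]e_α + [γ=α]e_α` (`bref_sub_bref`) — EXACTLY the argument of `PinfKer_axisReflect` in the variable `x − z`.  The field block
of `Pker` reads `Pker x z β γ = Re PinfKer β γ (z − x)` (second site minus first), so:
* `refK_Φ_PkerSwap` : the SITE-SWAPPED leg `Pkerˢˢ x z a b := Pker z x a b` (field block `Re PinfKer β γ (x − z)`) is `Φ N α`-INVARIANT for every `N`, `α`;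
* `refK_Φ_Pker_inl_inl` : the leg AS TYPED comes back TWISTED, `refK (Φ N α) Pker x z β γ = Re PinfKer β γ (z − x − 2[β=α]e_α + 2[γ=α]e_α)`, whence
  `refK_Φ_Pker_eq_iff` : `refK (Φ N α) Pker = Pker` ⟺ every entry `Re PinfKer β γ` is invariant under `v ↦ v − 2[β=α]e_α + 2[γ=α]e_α` — vacuous on the
  diagonal, a `2e_α`-PERIODICITY of the off-diagonal-in-`α` entries otherwise (`re_PinfKer_periodic_of_refK_Φ_Pker`).  NO non-vanishing of an off-diagonal entry
  is claimed here; with one, `refK (Φ N α) Pker ≠ Pker` follows.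
So, of the two readings displayed since N-d1leaf02g9-1 ∕ N-d1leaf02g10-3, the «straight» one (leg `Pkerˢˢ`, form `MFˢˢ = MFᶠ`, natural-order jets: R9∕R10) is the
one in which the R5′ socket's «leg map fixing the leg AND transporting the data» is available with the laws of record (all stated for `Φ N α`).  §2 supplies the
swapped pair's letters (`bdd_PkerSwap`, `PkerSwap_translate`, `decays_MFSwap`, `spr_MFSwap`, `comp_PkerSwap_idF`, `comp_idF_PkerSwap`; with R9 the four relative
rules) and `consistency_contact₂_perfectSwap` (R6 at `(Pkerˢˢ, MFˢˢ, idF)`, twin of R7's `consistency_contact₂_perfect`).  The road's ENDs are generic in the kernel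
`K` (`RemainderLedgerCov.hasym_perfect_of_pieces_cov`); which NAME (`Pker` or its site swap) `PiBF` should carry is the owner's call — nothing is re-typed here.
Provenance: D1 formalisation swarm seat b2b-balaban-beta-d1-formalise-leaf-02 gen 11 (road FP engine lineage), 2026-08-21.
-/

noncomputable section

namespace Summit.QuantumFields.BalabanUV.Beta.FP.PerfectLegSwapReflection

open Finset
open scoped BigOperators
open Literature.MathematicalPhysics.QuantumFieldTheory.Balaban1983to89
open Literature.MathematicalPhysics.QuantumFieldTheory.Balaban1983to89.Beta
open B6BondElimination (unitVec unitVec_apply)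
open PolarizationSign (axisReflect axisReflect_apply reflSign)
open ExpKernelCalculus (MKer Site Decays comp tr bubble tadpole shiftK)
open KernelWard (Bdd)
open KernelReflection (refK refK_apply)
open ResolventReflection (bref bref_apply Φ Φ_r_inl Φ_s_inl reflSign_mul_self)
open OneStepResolventKernel (Fib)
open Summit.QuantumFields.BalabanUV.Beta.TameKernelCalculus (Spr Loc)
open Summit.QuantumFields.BalabanUV.Beta.ChartConjugation (conjV conjW)
open Summit.QuantumFields.BalabanUV.Beta.BorderedHessian (diagK)
open Summit.QuantumFields.BalabanUV.Beta.FP.PerfectPropagatorKernel (PinfKer)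
open Summit.QuantumFields.BalabanUV.Beta.FP.PerfectPolarization (Pker Pker_inl_inl Pker_inl_inr Pker_inr_inl Pker_inr_inr Pker_translate)
open Summit.QuantumFields.BalabanUV.Beta.FP.PerfectPropagatorLegData (A0P)
open Summit.QuantumFields.BalabanUV.Beta.FP.PerfectPolarizationWard (bdd_Pker)
open Summit.QuantumFields.BalabanUV.Beta.FP.PerfectPropagatorInverse (MF idF decays_MF MF_translate)
open Summit.QuantumFields.BalabanUV.Beta.FP.PerfectPropagatorReflection (PinfKer_axisReflect)
open Summit.QuantumFields.BalabanUV.Beta.FP.WardSandwichEngine (idM comp_idM idM_comp)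
open Summit.QuantumFields.BalabanUV.Beta.FP.PerfectPolarizationWardLetters (fmask fmask_inl fmask_inr idF_eq_idM)
open Summit.QuantumFields.BalabanUV.Beta.FP.SliceContactChart (spr_MF spr_idF comp_idF_diagK_comm)
open Summit.QuantumFields.BalabanUV.Beta.FP.PerfectPairSiteSwap (comp_PkerSwap_MFSwap comp_MFSwap_PkerSwap MFt_eq_MFSwap)
open Summit.QuantumFields.BalabanUV.Beta.FP.ChartConjugationBounded (consistency_contact₂_of_conj)

/-! ## §1 The cell's leg maps against the two site orders of the perfect leg -/

/-- [folklore] **THE DIFFERENCE OF TWO REFLECTED FIELD-LEG BASE POINTS IN THE CELL's CONVENTION**: `bref α β x − bref α γ z = ε(x − z) − [β=α]e_α + [γ=α]e_α`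
— the printed argument of `PinfKer_axisReflect` in the variable `x − z` (the uniform `−e_α` of `sref` cancels). -/
theorem bref_sub_bref (α β γ : Fin 4) (x z : Site 4) :
    bref α β x - bref α γ z = axisReflect α (x - z) - (if β = α then unitVec α else 0) + (if γ = α then unitVec α else 0) := by
  funext i
  simp only [Pi.sub_apply, Pi.add_apply, bref_apply, axisReflect_apply]
  by_cases hi : i = α <;> by_cases hβ : β = α <;> by_cases hγ : γ = α <;> simp [hi, hβ, hγ, unitVec_apply] <;> ring

/-- [folklore] the same difference written against the TWISTED variable: `bref α γ z − bref α β x = ε(z − x − 2[β=α]e_α + 2[γ=α]e_α) − [β=α]e_α + [γ=α]e_α`. -/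
theorem bref_sub_bref_twist (α β γ : Fin 4) (x z : Site 4) :
    bref α γ z - bref α β x
      = axisReflect α (z - x - (2 : ℤ) • (if β = α then unitVec α else 0) + (2 : ℤ) • (if γ = α then unitVec α else 0))
          - (if β = α then unitVec α else 0) + (if γ = α then unitVec α else 0) := by
  funext i
  simp only [Pi.sub_apply, Pi.add_apply, Pi.smul_apply, bref_apply, axisReflect_apply, smul_eq_mul]
  by_cases hi : i = α <;> by_cases hβ : β = α <;> by_cases hγ : γ = α <;> simp [hi, hβ, hγ, unitVec_apply] <;> ring

/-- [our object] **THE SITE-SWAPPED PERFECT LEG IS INVARIANT UNDER THE CELL's REFLECTION LEG MAPS**: `refK (Φ N α) Pkerˢˢ = Pkerˢˢ` for every blocking `N` and axis `α`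
(`Pkerˢˢ x z a b := Pker z x a b`; its field block is `Re PinfKer β γ (x − z)`, relabelled by `bref_sub_bref` into the printed law `PinfKer_axisReflect`; the
multiplier blocks vanish). -/
theorem refK_Φ_PkerSwap (N : ℕ) (α : Fin 4) :
    refK (Φ N α) (fun x z a b => Pker z x a b) = fun x z a b => Pker z x a b := by
  funext x z a b
  rcases a with β | β <;> rcases b with γ | γ
  · simp only [refK_apply, Φ_s_inl, Φ_r_inl, Pker_inl_inl]
    rw [bref_sub_bref, PinfKer_axisReflect, Complex.re_ofReal_mul]
    have h1 := reflSign_mul_self α β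
    have h2 := reflSign_mul_self α γ
    set R := (PinfKer (d := 3) β γ (x - z)).re
    linear_combination (reflSign α γ * reflSign α γ * R) * h1 + R * h2
  · simp [refK_apply]
  · simp [refK_apply]
  · simp [refK_apply]

/-- [our object] **THE LEG AS TYPED COMES BACK TWISTED**: `refK (Φ N α) Pker x z (inl β) (inl γ) = Re PinfKer β γ (z − x − 2[β=α]e_α + 2[γ=α]e_α)` — the field block
of `Pker` reads `Re PinfKer β γ (z − x)` (second site minus first), so the unit vectors of `bref_sub_bref` enter with the signs OPPOSITE to `PinfKer_axisReflect`,
and the law absorbs them only after the fibre-dependent shift `2([γ=α] − [β=α])e_α`. -/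
theorem refK_Φ_Pker_inl_inl (N : ℕ) (α : Fin 4) (x z : Site 4) (β γ : Fin 4) :
    refK (Φ N α) Pker x z (Sum.inl β) (Sum.inl γ)
      = (PinfKer (d := 3) β γ (z - x - (2 : ℤ) • (if β = α then unitVec α else 0) + (2 : ℤ) • (if γ = α then unitVec α else 0))).re := by
  simp only [refK_apply, Φ_s_inl, Φ_r_inl, Pker_inl_inl]
  rw [bref_sub_bref_twist, PinfKer_axisReflect, Complex.re_ofReal_mul]
  have h1 := reflSign_mul_self α β
  have h2 := reflSign_mul_self α γ
  set R := (PinfKer (d := 3) β γ (z - x - (2 : ℤ) • (if β = α then unitVec α else 0) + (2 : ℤ) • (if γ = α then unitVec α else 0))).re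
  linear_combination (reflSign α γ * reflSign α γ * R) * h1 + R * h2

/-- [our object] **`Φ N α`-INVARIANCE OF `Pker` AS TYPED ⟺ A FIBRE-DEPENDENT SHIFT INVARIANCE OF THE PERFECT PROPAGATOR KERNEL**:
`refK (Φ N α) Pker = Pker ↔ ∀ β γ v, Re PinfKer β γ (v − 2[β=α]e_α + 2[γ=α]e_α) = Re PinfKer β γ v` (vacuous for `β = γ`; a `2e_α`-periodicity of the
off-diagonal-in-`α` entries otherwise).  A located obstruction: nothing about the VALUES of `PinfKer` is asserted. -/
theorem refK_Φ_Pker_eq_iff (N : ℕ) (α : Fin 4) :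
    refK (Φ N α) Pker = Pker ↔
      ∀ (β γ : Fin 4) (v : Site 4),
        (PinfKer (d := 3) β γ (v - (2 : ℤ) • (if β = α then unitVec α else 0) + (2 : ℤ) • (if γ = α then unitVec α else 0))).re
          = (PinfKer (d := 3) β γ v).re := by
  constructor
  · intro h β γ v
    have e := congrFun (congrFun (congrFun (congrFun h 0) v) (Sum.inl β)) (Sum.inl γ)
    rw [refK_Φ_Pker_inl_inl, Pker_inl_inl, sub_zero] at e
    exact e
  · intro h
    funext x z a b
    rcases a with β | β <;> rcases b with γ | γ
    · rw [refK_Φ_Pker_inl_inl, Pker_inl_inl]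
      exact h β γ (z - x)
    · simp [refK_apply]
    · simp [refK_apply]
    · simp [refK_apply]

/-- [our object] **THE OBSTRUCTION, SPELLED OUT**: if `Pker` as typed were `Φ N α`-invariant, every off-diagonal entry `Re PinfKer α γ`, `γ ≠ α`, would be
`2e_α`-PERIODIC: `Re PinfKer α γ (v − 2e_α) = Re PinfKer α γ v`. -/
theorem re_PinfKer_periodic_of_refK_Φ_Pker {N : ℕ} {α : Fin 4} (h : refK (Φ N α) Pker = Pker) {γ : Fin 4} (hγ : γ ≠ α) (v : Site 4) :
    (PinfKer (d := 3) α γ (v - (2 : ℤ) • unitVec α)).re = (PinfKer (d := 3) α γ v).re := by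
  have e := (refK_Φ_Pker_eq_iff N α).1 h α γ v
  simpa [hγ] using e

/-! ## §2 The swapped pair's letters and the R5′ socket's consistency identity at `(Pkerˢˢ, MFˢˢ, idF)` -/

/-- [our object] the site-swapped perfect leg is bounded (`PerfectPolarizationWard.bdd_Pker`). -/
theorem bdd_PkerSwap : Bdd (fun x z a b => Pker z x a b) A0P := fun x z a b => bdd_Pker z x a b

/-- [our object] the site-swapped perfect leg is translation invariant (`Pker_translate`). -/
theorem PkerSwap_translate (v : Site 4) : shiftK v (fun x z a b => Pker z x a b) = fun x z a b => Pker z x a b := by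
  funext x z a b
  have h := congrFun (congrFun (congrFun (congrFun (Pker_translate v) z) x) a) b
  exact h

/-- [our object] the site-swapped (= fibre-transposed, R9 `MFt_eq_MFSwap`) perfect Feynman form decays at the rate of `decays_MF`. -/
theorem decays_MFSwap : ∃ C, 0 ≤ C ∧ Decays (fun x z a b => MF z x a b) C (B5Symbol166Strip.kappa166 4 / 4) := by
  obtain ⟨C, hC0, hC⟩ := decays_MF
  refine ⟨C, hC0, ?_⟩
  rw [← MFt_eq_MFSwap]
  intro x z a b
  exact hC x z b a

/-- [our object] the site-swapped perfect Feynman form is spread. -/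
theorem spr_MFSwap : Spr (fun x z a b => MF z x a b) := by
  obtain ⟨C, _, hC⟩ := decays_MFSwap
  exact ⟨C, B5Symbol166Strip.kappa166 4 / 4, by have := B5Symbol166Strip.kappa166_pos 4; positivity, hC⟩

/-- [our object] the site-swapped perfect Feynman form is translation invariant. -/
theorem MFSwap_translate (v : Site 4) : shiftK v (fun x z a b => MF z x a b) = fun x z a b => MF z x a b := by
  funext x z a b
  have h := congrFun (congrFun (congrFun (congrFun (MF_translate v) z) x) a) b
  exact h

/-- [our object] **RULE `A∘E = A` AT THE SWAPPED LEG**: `comp Pkerˢˢ idF = Pkerˢˢ`. -/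
theorem comp_PkerSwap_idF : comp (fun x z a b => Pker z x a b) idF = fun x z a b => Pker z x a b := by
  funext x z a b
  rw [idF_eq_idM, comp_idM]
  show Pker z x a b * fmask b = Pker z x a b
  rcases b with β | j
  · rw [fmask_inl, mul_one]
  · rcases a with α | i
    · rw [Pker_inl_inr, zero_mul]
    · rw [Pker_inr_inr, zero_mul]

/-- [our object] **RULE `E∘A = A` AT THE SWAPPED LEG**: `comp idF Pkerˢˢ = Pkerˢˢ`. -/
theorem comp_idF_PkerSwap : comp idF (fun x z a b => Pker z x a b) = fun x z a b => Pker z x a b := by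
  funext x z a b
  rw [idF_eq_idM, idM_comp]
  show fmask a * Pker z x a b = Pker z x a b
  rcases a with α | i
  · rw [fmask_inl, one_mul]
  · rcases b with β | j
    · rw [Pker_inr_inl, mul_zero]
    · rw [Pker_inr_inr, mul_zero]

/-- [our object] **THE (Kcov) SOCKET's CONSISTENCY IDENTITY AT THE SWAPPED PERFECT PAIR, DIAGONAL GENERATORS** — R6 `consistency_contact₂_of_conj` at
`(A, M, E) := (Pkerˢˢ, MFˢˢ, idF)` with the four relative rules DISCHARGED (R9 `comp_PkerSwap_MFSwap` ∕ `comp_MFSwap_PkerSwap`; `comp_PkerSwap_idF` ∕ `comp_idF_PkerSwap`) and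
the commutation DISCHARGED for diagonal generators (R7 `comp_idF_diagK_comm`).  Displayed: localisation of the vertices `V μ y`, of the generators `diagK (g μ y)`, of
`X₂`, of the remainder `Rm`, and `tadpole Pkerˢˢ Rm = 0`.  Twin of R7's `consistency_contact₂_perfect` (which sits at `(Pker, MF, idF)`). -/
theorem consistency_contact₂_perfectSwap {V : Fin 4 → Site 4 → MKer 4 (Fib 3)} {g : Fin 4 → Site 4 → (Site 4 → Fib 3 → ℝ)}
    {X₂ Rm : Fin 4 → Site 4 → Fin 4 → Site 4 → MKer 4 (Fib 3)} (hV : ∀ μ y, Loc (V μ y)) (hg : ∀ μ y, Loc (diagK (g μ y)))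
    (hX₂ : ∀ μ y ν y', Loc (X₂ μ y ν y')) (hRmL : ∀ μ y ν y', Loc (Rm μ y ν y'))
    (hRm0 : ∀ μ y ν y', tadpole (fun x z a b => Pker z x a b) (Rm μ y ν y') = 0) :
    ∀ (μ ν : Fin 4) (z : Site 4),
      tadpole (fun x z a b => Pker z x a b)
          (conjW (fun x z a b => MF z x a b) (V μ 0) (V ν z) (diagK (g μ 0)) (diagK (g ν z)) (X₂ μ 0 ν z) + Rm μ 0 ν z) =
        bubble (fun x z a b => Pker z x a b) (conjV (fun x z a b => MF z x a b) (diagK (g μ 0))) (V ν z)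
          + bubble (fun x z a b => Pker z x a b) (V μ 0) (conjV (fun x z a b => MF z x a b) (diagK (g ν z)))
          + bubble (fun x z a b => Pker z x a b) (conjV (fun x z a b => MF z x a b) (diagK (g μ 0)))
              (conjV (fun x z a b => MF z x a b) (diagK (g ν z))) :=
  consistency_contact₂_of_conj (X := fun μ y => diagK (g μ y)) bdd_PkerSwap spr_MFSwap spr_idF comp_PkerSwap_MFSwap comp_MFSwap_PkerSwap
    comp_PkerSwap_idF comp_idF_PkerSwap hV hg hX₂ (fun μ y => comp_idF_diagK_comm (g μ y)) hRmL hRm0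

end Summit.QuantumFields.BalabanUV.Beta.FP.PerfectLegSwapReflection

end
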